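import Summits.Ventures.PercRepro.RankLevelSetMultFifteenA
import Summits.Ventures.PercRepro.RankLevelSetMultFifteenB

/-!
# PercRepro — THE 3-EXCHANGE MULTIPLICITY AT `ν = 3`: a rank-`q` set of `q + 3` elements has `≥ 15` spanning
`(q+1)`-subsets (p8 g4, S3 §3q)

`proofs/SUBCLAIM-S3-p8.md` §3q. The TRIPLE (`card_spanF_ge_tri`, RankLevelSetTripleMult) gives `ν(3ν − 1)/2 = 12` at
`ν = 3`: the sets `I ∪ {e}` (`3`) and `(I ∖ {z}) ∪ {e, e'}` with `z` on the fundamental circuit of `e` or of `e'`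
(`≥ 3` per pair, `9`). Write `S_e ⊆ I` for the SUPPORT of `e ∈ B ∖ I = {x, y, w}` (the basis elements on its
fundamental circuit; `|S_e| ≥ 2`, `|S_e ∪ S_e'| ≥ 3` by the line bound).
* If every two supports cover `≥ 4` basis elements, the pairs alone give `3·4 = 12` (`exists_pair_families`, the
  count kept exactly) and the total is `15`.
* If some two supports cover exactly `3`, say `S_x ∪ S_y = T`, and the three supports cover `≥ 4`, the 3-exchange sets
  `(I ∖ {z, z'}) ∪ {x, y, w}`, `z ∈ T`, `z' ∈ S_w ∖ T` (`exists_three_exchange_family`, RankLevelSetMultFifteenA) add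
  three more: `3 + 9 + 3 = 15`.
* If the three supports cover exactly `3` basis elements `U`, then `x, y, w ∈ cl(U)` and `U ∪ {x, y, w}` is a
  `6`-point plane whose `C(6, 4) = 15` four-subsets all span it (`exists_plane_family`, RankLevelSetMultFifteenB).
Hence `card_spanF_ge_fifteen : 15 ≤ #spanF` and, word for word as p7's `card_pairs_ge_sq`, `card_pairs_ge_fifteen`:
a rank-`q` set of `q + 3` elements lies in the fibre of `≥ 15` pairs. The combinatorial core was brute-forced first
(1,719,292 / 1,719,292 support triples on `|I| ≤ 7` covering `≥ 4` elements satisfy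
`Σ_pairs |S_e ∪ S_e'| + 3·[some pair covers 3] ≥ 12`; the only configurations below `12` cover exactly `3`). The
minimum `15` is attained (random simple binary matroids, `4000` samples: `1, 5, 15, 35, 102, 219` at `ν = 1 … 6`).
Axioms: standard.
-/

open scoped Matroid

namespace PercRepro

namespace S2

open Set Finset

variable {α : Type} {M : Matroid α}

open scoped Classical in
/-- **FIFTEEN**: a rank-`q` set `B` of `q + 3` elements (every circuit of `≥ 3` elements, every rank-`2` set of `≤ 3`
points) has at least `15` spanning `(q+1)`-subsets — the triple's `3 + 9` and three sets of the 3-exchange family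
`(I ∖ {z, z'}) ∪ {x, y, w}` when the three fundamental-circuit supports cover `≥ 4` basis elements (`12` from the pairs
alone when every two supports cover `≥ 4`), and all `C(6, 4) = 15` four-subsets of the `6`-point plane `U ∪ {x, y, w}`
when they cover exactly `3`. -/
theorem card_spanF_ge_fifteen [M.Finite] (q : ℕ) (hq : 1 ≤ q) (hcirc : ∀ C, M.IsCircuit C → 3 ≤ C.encard)
    (hline : ∀ L ⊆ M.E, M.eRk L = 2 → L.ncard ≤ 3)
    {B : Finset α} (hBE : (B : Set α) ⊆ M.E) (hBq : M.eRk (B : Set α) = (q : ℕ∞)) (hB3 : B.card = q + 3) :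
    15 ≤ (spanF M q B).card := by
  classical
  obtain ⟨I₀, hI₀⟩ := M.exists_isBasis (B : Set α) hBE
  have hI₀fin : I₀.Finite := B.finite_toSet.subset hI₀.subset
  set I : Finset α := hI₀fin.toFinset with hIdef
  have hIcoe : (I : Set α) = I₀ := Set.Finite.coe_toFinset _
  have hIB : I ⊆ B := by
    intro x hx
    rw [hIdef, Set.Finite.mem_toFinset] at hx
    exact_mod_cast hI₀.subset hx
  have hIcard : I.card = q := by
    have h := hI₀.encard_eq_eRk
    rw [hBq, ← hI₀fin.cast_ncard_eq] at h
    have h' : I₀.ncard = q := by exact_mod_cast h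
    rw [hIdef, ← Set.ncard_eq_toFinset_card _ hI₀fin]; exact h'
  have hIind : M.Indep (I : Set α) := by rw [hIcoe]; exact hI₀.indep
  have hBcl : (B : Set α) ⊆ M.closure (I : Set α) := by rw [hIcoe]; exact hI₀.subset_closure
  -- the two families of the triple, counted exactly
  obtain ⟨F₁₂, hF₁₂sub, hF₁₂card, hF₁₂miss⟩ := exists_pair_families q hq hBq hIind hIB hIcard hBcl
  set X : Finset α := B \ I with hXdef
  have hXcard : X.card = 3 := by
    rw [hXdef, Finset.card_sdiff, Finset.inter_eq_left.2 hIB, hIcard, hB3]; omega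
  have hXI : ∀ x ∈ X, x ∉ I := fun x hx => (Finset.mem_sdiff.1 hx).2
  have hXB : ∀ x ∈ X, x ∈ B := fun x hx => (Finset.mem_sdiff.1 hx).1
  have hXcl : ∀ x ∈ X, x ∈ M.closure (I : Set α) := fun x hx => hBcl (by exact_mod_cast hXB x hx)
  obtain ⟨x, y, w, hxy, hxw, hyw, hXeq⟩ := Finset.card_eq_three.1 hXcard
  have hxX : x ∈ X := by rw [hXeq]; simp
  have hyX : y ∈ X := by rw [hXeq]; simp
  have hwX : w ∈ X := by rw [hXeq]; simp
  -- the supports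
  set Sf : α → Finset α := fun e => I.filter (fun z => z ∈ M.fundCircuit e (I : Set α)) with hSf
  have hSfI : ∀ e, Sf e ⊆ I := fun e => Finset.filter_subset _ _
  have hpair : ∀ e ∈ X, ∀ e' ∈ X, e ≠ e' → 3 ≤ (Sf e ∪ Sf e').card := by
    intro e he e' he' hee'
    have h3 := three_le_card_filter_fundCircuit_pair hcirc hline hIind (hXcl e he) (hXI e he)
      (hXcl e' he') (hXI e' he') hee'
    rw [Finset.filter_or] at h3
    exact h3
  -- the filter of a pair `P = {e, e'}` is the union of the two supports
  have hfilter_pair : ∀ e e', e ≠ e' →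
      I.filter (fun z => ∃ x ∈ ({e, e'} : Finset α), z ∈ M.fundCircuit x (I : Set α)) = Sf e ∪ Sf e' := by
    intro e e' _
    rw [hSf, ← Finset.filter_or]
    apply Finset.filter_congr
    intro z _
    simp only [Finset.mem_insert, Finset.mem_singleton]
    constructor
    · rintro ⟨a, rfl | rfl, h⟩
      · exact Or.inl h
      · exact Or.inr h
    · rintro (h | h)
      · exact ⟨e, Or.inl rfl, h⟩
      · exact ⟨e', Or.inr rfl, h⟩
  have hsum_ge : ∀ m : ℕ, (∀ e ∈ X, ∀ e' ∈ X, e ≠ e' → m ≤ (Sf e ∪ Sf e').card) →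
      3 * m ≤ ∑ P ∈ X.powersetCard 2, (I.filter (fun z => ∃ e ∈ P, z ∈ M.fundCircuit e (I : Set α))).card := by
    intro m hm
    have : ∀ P ∈ X.powersetCard 2,
        m ≤ (I.filter (fun z => ∃ x ∈ P, z ∈ M.fundCircuit x (I : Set α))).card := by
      intro P hP
      rw [Finset.mem_powersetCard] at hP
      obtain ⟨e, e', hee', hPee'⟩ := Finset.card_eq_two.1 hP.2
      have heX : e ∈ X := hP.1 (by rw [hPee']; exact Finset.mem_insert_self e _)
      have he'X : e' ∈ X := hP.1 (by rw [hPee']; exact Finset.mem_insert_of_mem (Finset.mem_singleton_self e'))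
      rw [hPee', hfilter_pair e e' hee']
      exact hm e heX e' he'X hee'
    calc 3 * m = ∑ _P ∈ X.powersetCard 2, m := by
          rw [Finset.sum_const, Finset.card_powersetCard, hXcard, smul_eq_mul]
          norm_num [Nat.choose]
      _ ≤ _ := Finset.sum_le_sum this
  have hF₁₂card' : F₁₂.card = 3 + ∑ P ∈ X.powersetCard 2,
      (I.filter (fun z => ∃ e ∈ P, z ∈ M.fundCircuit e (I : Set α))).card := by
    rw [hF₁₂card, hXcard]
  have h9 := hsum_ge 3 (fun e he e' he' hee' => hpair e he e' he' hee')
  -- THE CASES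
  by_cases hU : 4 ≤ (Sf x ∪ Sf y ∪ Sf w).card
  · by_cases hall : 4 ≤ (Sf x ∪ Sf y).card ∧ 4 ≤ (Sf x ∪ Sf w).card ∧ 4 ≤ (Sf y ∪ Sf w).card
    · -- every two supports cover `≥ 4`: the pairs alone give `12`
      have h12 := hsum_ge 4 (by
        intro e he e' he' hee'
        rw [hXeq] at he he'
        simp only [Finset.mem_insert, Finset.mem_singleton] at he he'
        rcases he with rfl | rfl | rfl <;> rcases he' with rfl | rfl | rfl
        · exact absurd rfl hee'
        · exact hall.1
        · exact hall.2.1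
        · rw [Finset.union_comm]; exact hall.1
        · exact absurd rfl hee'
        · exact hall.2.2
        · rw [Finset.union_comm]; exact hall.2.1
        · rw [Finset.union_comm]; exact hall.2.2
        · exact absurd rfl hee')
      have := Finset.card_le_card hF₁₂sub
      omega
    · -- some two supports cover exactly `3`: the 3-exchange family
      have hfam : ∃ F : Finset (Set α), F.card = 3 ∧ F ⊆ spanF M q B ∧
          ∀ D ∈ F, ∃ z ∈ I, ∃ z' ∈ I, z ≠ z' ∧ z ∉ D ∧ z' ∉ D := by
        rw [not_and_or, not_and_or] at hall
        have hXeq' : B \ I = {x, y, w} := hXeq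
        rcases hall with h | h | h
        · push Not at h
          refine exists_three_exchange_family q hcirc hline hBq hIind hIB hIcard hBcl hxy hxw hyw hXeq'
            (by show (Sf x ∪ Sf y).card ≤ 3; omega) ?_
          intro hsub
          have hUeq : Sf x ∪ Sf y ∪ Sf w = Sf x ∪ Sf y := Finset.union_eq_left.2 hsub
          rw [hUeq] at hU
          omega
        · push Not at h
          have hXeq'' : B \ I = {x, w, y} := by rw [hXeq', Finset.pair_comm]
          refine exists_three_exchange_family q hcirc hline hBq hIind hIB hIcard hBcl hxw hxy hyw.symm hXeq''
            (by show (Sf x ∪ Sf w).card ≤ 3; omega) ?_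
          intro hsub
          have hUeq : Sf x ∪ Sf y ∪ Sf w = Sf x ∪ Sf w := by
            rw [Finset.union_right_comm]; exact Finset.union_eq_left.2 hsub
          rw [hUeq] at hU
          omega
        · push Not at h
          have hXeq'' : B \ I = {y, w, x} := by
            rw [hXeq', Finset.insert_comm, Finset.pair_comm]
          refine exists_three_exchange_family q hcirc hline hBq hIind hIB hIcard hBcl hyw hxy.symm hxw.symm
            hXeq'' (by show (Sf y ∪ Sf w).card ≤ 3; omega) ?_
          intro hsub
          have hUeq : Sf x ∪ Sf y ∪ Sf w = Sf y ∪ Sf w := by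
            rw [Finset.union_assoc]; exact Finset.union_eq_right.2 hsub
          rw [hUeq] at hU
          omega
      obtain ⟨F₃, hF₃card, hF₃sub, hF₃miss⟩ := hfam
      have hdisj : Disjoint F₁₂ F₃ := by
        rw [Finset.disjoint_left]
        intro D hD12 hD3
        obtain ⟨z₀, hz₀⟩ := hF₁₂miss D hD12
        obtain ⟨z, hzI, z', hz'I, hzz', hzD, hz'D⟩ := hF₃miss D hD3
        by_cases hz : z = z₀
        · exact hz'D (hz₀ z' hz'I (by rw [← hz]; exact hzz'.symm))
        · exact hzD (hz₀ z hzI hz)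
      have hunion : (F₁₂ ∪ F₃).card ≤ (spanF M q B).card :=
        Finset.card_le_card (Finset.union_subset hF₁₂sub hF₃sub)
      rw [Finset.card_union_of_disjoint hdisj, hF₃card] at hunion
      omega
  · -- the three supports cover exactly `3` basis elements: the `6`-point plane
    push Not at hU
    set U : Finset α := Sf x ∪ Sf y ∪ Sf w with hUdef
    have hUI : U ⊆ I := Finset.union_subset (Finset.union_subset (hSfI x) (hSfI y)) (hSfI w)
    have hU3 : U.card = 3 := by
      have h3 := hpair x hxX y hyX hxy
      have hle : (Sf x ∪ Sf y).card ≤ U.card := Finset.card_le_card Finset.subset_union_left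
      omega
    -- `X ⊆ cl(U)`: every `e ∈ X` lies in the closure of its support
    have hSfcl : ∀ e ∈ X, e ∈ M.closure ((Sf e : Finset α) : Set α) := by
      intro e he
      have hC : M.IsCircuit (M.fundCircuit e (I : Set α)) :=
        hIind.fundCircuit_isCircuit (hXcl e he) (by simpa using hXI e he)
      have heC : e ∈ M.fundCircuit e (I : Set α) := M.mem_fundCircuit e _
      have h1 : e ∈ M.closure (M.fundCircuit e (I : Set α) \ {e}) := hC.mem_closure_sdiff_singleton_of_mem heC
      refine M.closure_subset_closure ?_ h1
      intro a ha
      have haC : a ∈ M.fundCircuit e (I : Set α) := ha.1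
      have hae : a ≠ e := by simpa using ha.2
      rcases M.fundCircuit_subset_insert e (I : Set α) haC with rfl | haI
      · exact absurd rfl hae
      · rw [Finset.mem_coe, hSf, Finset.mem_filter]
        exact ⟨by exact_mod_cast haI, haC⟩
    have hXclU : (X : Set α) ⊆ M.closure (U : Set α) := by
      intro e he
      have heX : e ∈ X := by exact_mod_cast he
      refine M.closure_subset_closure ?_ (hSfcl e heX)
      rw [hXeq] at heX
      simp only [Finset.mem_insert, Finset.mem_singleton] at heX
      rcases heX with rfl | rfl | rfl
      · exact_mod_cast (Finset.subset_union_left.trans Finset.subset_union_left : Sf e ⊆ U)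
      · exact_mod_cast (Finset.subset_union_right.trans Finset.subset_union_left : Sf e ⊆ U)
      · exact_mod_cast (Finset.subset_union_right : Sf e ⊆ U)
    obtain ⟨FA, hFAcard, hFAsub⟩ :=
      exists_plane_family q hcirc hline hBE hBq hIind hIB hIcard hBcl hXcard hUI hU3 hXclU
    calc 15 = FA.card := hFAcard.symm
      _ ≤ (spanF M q B).card := Finset.card_le_card hFAsub

open scoped Classical in
/-- **The multiplicity `15` of the pairs**: a rank-`q` set `B` of `q + 3` elements lies in the level-`(q+3)` fibre of
at least `15` pairs (p7's `card_pairs_ge_sq` on `card_spanF_ge_fifteen`). -/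
theorem card_pairs_ge_fifteen [M.Finite] (q : ℕ) (hq : 1 ≤ q) (hcirc : ∀ C, M.IsCircuit C → 3 ≤ C.encard)
    (hline : ∀ L ⊆ M.E, M.eRk L = 2 → L.ncard ≤ 3)
    {B : Finset α} (hBE : (B : Set α) ⊆ M.E) (hBq : M.eRk (B : Set α) = (q : ℕ∞)) (hB3 : B.card = q + 3) :
    15 ≤ ((Matroid.pairsF M q).filter (fun p => p.1 ∪ p.2 ⊆ (B : Set α) ∧
      (B : Set α) ⊆ M.closure (p.1 ∪ p.2))).card := by
  classical
  refine (card_spanF_ge_fifteen q hq hcirc hline hBE hBq hB3).trans ?_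
  apply Finset.card_le_card_of_surjOn (fun p : Set α × Set α => p.1 ∪ p.2)
  intro D hD
  rw [Finset.mem_coe, mem_spanF] at hD
  obtain ⟨D', hD'B, hD'card, hD'q, hBcl, rfl⟩ := hD
  have hD'E : (D' : Set α) ⊆ M.E := (Finset.coe_subset.2 hD'B).trans hBE
  have hD'ncard : (D' : Set α).ncard = q + 1 := by rw [Set.ncard_coe_finset]; exact hD'card
  obtain ⟨C, B', hC, hCD, hB'D, hdisj, hcard, hDcl⟩ :=
    Matroid.exists_circuit_extension_exact hD'E hD'q (by rw [hD'ncard]; omega)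
  have hCfin : C.Finite := D'.finite_toSet.subset hCD
  have hB'fin : B'.Finite := D'.finite_toSet.subset hB'D
  have hunion_sub : C ∪ B' ⊆ (D' : Set α) := Set.union_subset hCD hB'D
  have hunion_card : (C ∪ B').ncard = q + 1 := by
    rw [Set.ncard_union_eq hdisj.symm hCfin hB'fin]; exact hcard
  have hunion : C ∪ B' = (D' : Set α) :=
    Set.eq_of_subset_of_ncard_le hunion_sub (by rw [hunion_card, hD'ncard]) D'.finite_toSet
  have hC3 : 3 ≤ C.ncard := by
    have := hcirc C hC
    rw [← hCfin.cast_ncard_eq] at this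
    exact_mod_cast this
  have hCle : C.ncard ≤ q + 1 := by omega
  refine ⟨(C, B'), ?_, ?_⟩
  · rw [Finset.mem_coe, Finset.mem_filter]
    refine ⟨?_, ?_, ?_⟩
    · unfold Matroid.pairsF
      rw [Finset.mem_filter]
      refine ⟨?_, hdisj, by show M.eRk (C ∪ B') ≤ q; rw [hunion]; exact hD'q.le⟩
      rw [Finset.mem_biUnion]
      refine ⟨C.ncard, by rw [Finset.mem_Icc]; omega, ?_⟩
      rw [Finset.mem_product]
      refine ⟨Matroid.mem_circF.2 ⟨hC, rfl⟩, ?_⟩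
      apply Matroid.mem_subsF_of
      · rw [Matroid.coe_groundF]; exact hB'D.trans hD'E
      · show B'.ncard = q + 1 - C.ncard
        omega
    · show C ∪ B' ⊆ (B : Set α)
      rw [hunion]; exact_mod_cast hD'B
    · show (B : Set α) ⊆ M.closure (C ∪ B')
      rw [hunion]; exact hBcl
  · exact hunion

end S2

end PercRepro
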